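import Literature.Topology.FourManifolds.LinkSurgeryUniqueness
import Literature.Topology.FourManifolds.KirbyMovesIsotopyProofs
import HarnessLib

/-!
# Moves on surgery presentations of a link: ambient isotopies and locality

Topic `Literature/Topology/FourManifolds`; infrastructure for the uniqueness of Dehn surgery on a
framed link (`Literature.Topology.FourManifolds.FramedLink.IsSurgery.nonempty_diffeomorph`, `KirbyMovesSurgery.lean`, leaf (U) of
`Literature.Topology.FourManifolds.KirbyEquivalent.nonempty_diffeomorph`). Recall (`LinkSurgeryUniqueness.lean`) that
`L.IsSurgeryPresentation IY Y ν` says that the manifold `Y` is surgery on the link `L`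
*presented with* the oriented tubular neighbourhoods `ν i` (open smooth embeddings of the link
complement and of one solid torus per component, glued along `Link.surgeryRel ν i`), and that two
manifolds presented with the *same* `ν` are diffeomorphic
(`Link.IsSurgeryPresentation.nonempty_diffeomorph`). This file records two elementary moves
changing `ν` in a presentation of a fixed `Y`; everything is proved:

* `Literature.Topology.FourManifolds.Link.IsSurgeryPresentation.isoTransport` — **transport along an ambient isotopy**: if `Y`
  is presented with `ν` and the stage `F t` of an ambient isotopy of `S³` carries `L` to `L'`,
  then `Y` is presented with the transported neighbourhoods `F t ∘ ν i`
  (`Knot.TubularNbhd.isoTransport`, `KirbyMovesIsotopyProofs.lean`, which also shows that they are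
  oriented and have the same framing integers); the presentation-level form of the tree's
  `FramedLink.IsSurgery.isoTransport` (Rolfsen, *Knots and Links* (1976), §9.F: surgery is
  transported along ambient isotopies);
* `Literature.Topology.FourManifolds.Link.isSurgeryPresentation_congr` — **locality**: the presentation only depends on the
  restriction of the `ν i` to the open unit disc bundle `S¹ × D̊²` (the surgery relation
  `Knot.TubularNbhd.glueRel` only involves points `ν (u, t • v)` with `0 < t < 1`, `‖v‖ = 1`), so
  tubular neighbourhoods agreeing there present the same manifolds (Kosinski, *Differential
  Manifolds* (1993), Ch. VI §1: a gluing only depends on the identification of the glued open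
  sets).

## References

* D. Rolfsen, *Knots and Links*, Publish or Perish (1976), §9.F. [Rolfsen1976]
* A. Kosinski, *Differential Manifolds*, Academic Press (1993), Ch. VI §1. [Kosinski1993]
-/

noncomputable section

open Set Function
open scoped Manifold ContDiff Topology

namespace Literature.Topology.FourManifolds

/-- Local notation: `𝔼 n` is the model Euclidean space `EuclideanSpace ℝ (Fin n)`. -/
local notation "𝔼 " n:arg => EuclideanSpace ℝ (Fin n)

/-- Local notation: `𝕊 n` is the unit sphere in `EuclideanSpace ℝ (Fin (n + 1))`. -/
local notation "𝕊 " n:arg => (Metric.sphere (0 : EuclideanSpace ℝ (Fin (n + 1))) 1)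

/-! ### Locality of the surgery relation -/

namespace Knot.TubularNbhd

variable {K : 𝕊 1 → 𝕊 3}

/-- **The surgery relation only sees the open unit disc bundle**: tubular neighbourhoods which
agree on `S¹ × D̊²` have the same gluing relation `glueRel` (it only involves the points
`ν (u, t • v)` with `0 < t < 1` and `‖v‖ = 1`). [folklore] -/
theorem glueRel_congr {ν ν' : Knot.TubularNbhd K}
    (h : ∀ (x : 𝕊 1) (w : 𝔼 2), ‖w‖ < 1 → ν (x, w) = ν' (x, w)) (a : 𝕊 3) (b : (𝔼 2) × (𝕊 1)) :
    ν.glueRel a b ↔ ν'.glueRel a b := by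
  have hnorm : ∀ t ∈ Ioo (0 : ℝ) 1, ‖t • ((b.2 : 𝕊 1) : 𝔼 2)‖ < 1 := fun t ht => by
    rw [norm_smul, norm_eq_of_mem_sphere, mul_one, Real.norm_of_nonneg ht.1.le]
    exact ht.2
  constructor
  · rintro ⟨u, t, ht, hb, ha⟩
    exact ⟨u, t, ht, hb, by rw [ha, h _ _ (hnorm t ht)]⟩
  · rintro ⟨u, t, ht, hb, ha⟩
    exact ⟨u, t, ht, hb, by rw [ha, ← h _ _ (hnorm t ht)]⟩

end Knot.TubularNbhd

section Surgery

variable {EY HY : Type*} [NormedAddCommGroup EY] [NormedSpace ℝ EY] [TopologicalSpace HY]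
  {IY : ModelWithCorners ℝ EY HY} {Y : Type*} [TopologicalSpace Y] [ChartedSpace HY Y]
  {ι : Type*} [Finite ι]

namespace Link

/-- **Locality of surgery presentations**: if two families of tubular neighbourhoods of the
components of `L` agree on the open unit disc bundles `S¹ × D̊²`, a manifold is presented with
the one family iff it is presented with the other (the surgery relations coincide,
`Knot.TubularNbhd.glueRel_congr`). Kosinski (1993), Ch. VI §1. [folklore] -/
theorem isSurgeryPresentation_congr {L : Link ι} {ν ν' : ∀ i, Knot.TubularNbhd (L.component i)}
    (h : ∀ i (x : 𝕊 1) (w : 𝔼 2), ‖w‖ < 1 → ν i (x, w) = ν' i (x, w)) :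
    L.IsSurgeryPresentation IY Y ν ↔ L.IsSurgeryPresentation IY Y ν' := by
  have key : ∀ i (a : L.complement) (b : solidTorus),
      Link.surgeryRel ν i a b ↔ Link.surgeryRel ν' i a b := fun i a b =>
    Knot.TubularNbhd.glueRel_congr (h i) _ _
  unfold Link.IsSurgeryPresentation
  constructor
  · rintro ⟨jA, jB, hA, hAo, hB, hcov, hdisj, hglue⟩
    exact ⟨jA, jB, hA, hAo, hB, hcov, hdisj, fun i a b => (hglue i a b).trans (key i a b)⟩
  · rintro ⟨jA, jB, hA, hAo, hB, hcov, hdisj, hglue⟩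
    exact ⟨jA, jB, hA, hAo, hB, hcov, hdisj, fun i a b => (hglue i a b).trans (key i a b).symm⟩

/-- **Surgery presentations are transported along ambient isotopies.** If `Y` is surgery on `L`
presented with `ν`, and the stage `F t` of an ambient isotopy of `S³` carries `L` to `L'`
componentwise, then `Y` is surgery on `L'` presented with the transported tubular neighbourhoods
`F t ∘ ν i` (`Knot.TubularNbhd.isoTransport`): precompose the embedding of the link complement
with `(F t)⁻¹` (`Link.isoComplDiffeo`), keep the solid tori. The presentation-level form of
`FramedLink.IsSurgery.isoTransport`. Rolfsen (1976), §9.F. [cite: Rolfsen1976, §9.F] -/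
theorem IsSurgeryPresentation.isoTransport {L L' : Link ι}
    {ν : ∀ i, Knot.TubularNbhd (L.component i)} (h : L.IsSurgeryPresentation IY Y ν)
    (F : AmbientIsotopy (𝓡 3) (𝕊 3)) (t : ℝ)
    (hL : ∀ i x, F.toFun t (L.component i x) = L'.component i x) :
    L'.IsSurgeryPresentation IY Y fun i => (ν i).isoTransport F t (hL i) := by
  obtain ⟨jA, jB, hA, hAo, hB, hcov, hBdisj, hglue⟩ := h
  simp only [Link.IsSurgeryPresentation, Link.surgeryRel]
  refine ⟨jA ∘ Link.isoComplDiffeo F t hL, jB, hA.comp_diffeomorph _, ?_, hB, ?_, hBdisj,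
    fun i a b => ?_⟩
  · rw [Link.range_comp_isoComplDiffeo]
    exact hAo
  · rw [Link.range_comp_isoComplDiffeo]
    exact hcov
  · rw [comp_apply, hglue i (Link.isoComplDiffeo F t hL a) b]
    change (ν i).glueRel ((F.toDiffeomorph t).symm a) b ↔
      ((ν i).isoTransport F t (hL i)).glueRel a b
    constructor
    · rintro ⟨u, s, hs, hb, ha⟩
      refine ⟨u, s, hs, hb, ?_⟩
      have := congrArg (F.toDiffeomorph t) ha
      rwa [Diffeomorph.apply_symm_apply] at this
    · rintro ⟨u, s, hs, hb, ha⟩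
      refine ⟨u, s, hs, hb, ?_⟩
      rw [Knot.TubularNbhd.isoTransport_apply, ← AmbientIsotopy.coe_toDiffeomorph] at ha
      rw [ha, Diffeomorph.symm_apply_apply]

omit [Finite ι] in
/-- Transported tubular neighbourhoods with pairwise disjoint images have pairwise disjoint
images. [folklore] -/
theorem pairwise_disjoint_range_isoTransport {L L' : Link ι}
    {ν : ∀ i, Knot.TubularNbhd (L.component i)}
    (hdisj : Pairwise fun i j => Disjoint (range (ν i)) (range (ν j)))
    (F : AmbientIsotopy (𝓡 3) (𝕊 3)) (t : ℝ)
    (hL : ∀ i x, F.toFun t (L.component i x) = L'.component i x) :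
    Pairwise fun i j => Disjoint (range ((ν i).isoTransport F t (hL i)))
      (range ((ν j).isoTransport F t (hL j))) := fun i j hij => by
  change Disjoint (range ⇑((ν i).isoTransport F t (hL i))) (range ⇑((ν j).isoTransport F t (hL j)))
  rw [Knot.TubularNbhd.range_isoTransport, Knot.TubularNbhd.range_isoTransport]
  exact (Set.disjoint_image_iff (F.bijective t).1).2 (hdisj hij)

end Link

end Surgery

end Literature.Topology.FourManifolds

end
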